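import Literature.Probability.LatticeModels.SahiThirdOrderCorrelation
import Literature.Probability.Percolation.StrongHarrisThreePoint
import HarnessLib

/-!
# Sahi's third-order functional on the three pairwise-separation events of three vertices

Topic `Literature/Probability/Percolation`.  Bernoulli bond percolation `μ = prodBernoulli w` with
arbitrary edge weights on a finite vertex type `V`, three vertices `a, b, c`, and the three DECREASING
events `{a ↮ b} = (openConn a b)ᶜ`, `{a ↮ c}`, `{b ↮ c}`.  Everything here is PROVED; no definition and no
named fact is introduced.

## Sources, as printed, and status

* Sahi's functional for three events (tree `Literature.Probability.LatticeModels.sahiE3`):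
  `E₃(A,B,C) = 2μ(ABC) + μ(A)μ(B)μ(C) − μ(A)μ(BC) − μ(B)μ(AC) − μ(C)μ(AB)` [cite: LiebSahi2021, eq. (2.1) (arXiv p. 5)];
  "**Conjecture 5.** For a product measure `μ` and increasing `A, B, C ⊆ Ω`,
  `2μ(ABC) − [μ(AB)μ(C) + μ(AC)μ(B) + μ(BC)μ(A)] + μ(A)μ(B)μ(C) ≥ 0`" — "the case `k = 3`, which has to date
  proved thoroughly intractable" [cite: Kahn2022, Conjecture 5 (arXiv p. 3)] (equivalently for three
  decreasing events, by `p ↦ 1 − p`).  OPEN in print; the proved cases (Sahi 2008, Blinovsky 2014,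
  Lieb–Sahi 2022) all have a slot whose conditional covariance is nonnegative (tree
  `prodBernoulli_sahiE3_nonneg_of_condHarris`, `prodBernoulli_sahiE3_notReach_nonneg`).
* The three-point strong Harris–Kleitman (Aas–Gladkov) inequality, PROVED (tree
  `prodBernoulli_threePoint_strongHarris`): "`P(123) P(1|2|3) ≥ P(12|3) P(13|2) + P(12|3) P(1|23) + P(13|2) P(1|23)`"
  [cite: Gladkov2024StrongFKG, Cor. 4.2]; "it also proves inequality
  `(abc)(a|b|c) ≥ (ab|c)(ac|b) + (ab|c)(a|bc) + (ac|b)(a|bc)`, which was first conjectured in an unpublished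
  work of Erik Aas and proved in [G]" [cite: GladkovZimin2024, §5 (arXiv p. 8)].

## What is proved here (bookkeeping connecting the two printed objects; not stated in the sources)

Write the five three-point cells as `t = μ(abc)`, `q = μ(a|b|c)`, `u₃ = μ(ab|c)`, `u₂ = μ(ac|b)`,
`u₁ = μ(a|bc)`, `e₂ = u₃u₂ + u₃u₁ + u₂u₁`, `e₃ = u₃u₂u₁`.
* `prodBernoulli_sahiE3_pairSep_eq` — the identity
  `E₃({a↮b},{a↮c},{b↮c}) = (1 + t)·(q·t − e₂) − e₃`:
  Sahi's functional on the three pairwise-separation events is the Aas–Gladkov form `q·t − e₂` times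
  `(1 + t)`, minus the cubic term `e₃`.  (Pure measure bookkeeping on the partition of the configuration
  space into the five cells, plus `ring`.)
* `prodBernoulli_sahiE3_pairSep_ge` — the PROVED part of Kahn's Conjecture 5 on this triple:
  `E₃({a↮b},{a↮c},{b↮c}) ≥ −u₃u₂u₁`, from the identity and the Aas–Gladkov inequality.  Whether
  `E₃ ≥ 0` here, i.e. `q·t − e₂ ≥ e₃/(1+t)`, is an instance of the open conjecture (on the triangle with
  edge weights `α, β, γ` one computes `E₃ = αβγ·q·(1 + t − q) ≥ 0`, so the factor `1/(1+t)` is sharp).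
-/

namespace Literature.Probability.Percolation

open MeasureTheory Literature.Probability.LatticeModels

variable {V : Type*} [Finite V]

omit [Finite V] in
/-- `{a↔b} ∩ {b↔c} = {a↔b} ∩ {a↔c}` (transitivity of open connection). [folklore] -/
private theorem openConn_inter_bc_eq (a b c : V) :
    (openConn a b ∩ openConn b c : Set (BondConfig V)) = openConn a b ∩ openConn a c := by
  ext ω
  constructor
  · rintro ⟨hab, hbc⟩
    exact ⟨hab, SimpleGraph.Reachable.trans hab hbc⟩
  · rintro ⟨hab, hac⟩
    exact ⟨hab, SimpleGraph.Reachable.trans (SimpleGraph.Reachable.symm hab) hac⟩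

omit [Finite V] in
/-- `{a↔c} ∩ {b↔c} = {a↔b} ∩ {a↔c}` (transitivity of open connection). [folklore] -/
private theorem openConn_inter_ac_bc_eq (a b c : V) :
    (openConn a c ∩ openConn b c : Set (BondConfig V)) = openConn a b ∩ openConn a c := by
  ext ω
  constructor
  · rintro ⟨hac, hbc⟩
    exact ⟨SimpleGraph.Reachable.trans hac (SimpleGraph.Reachable.symm hbc), hac⟩
  · rintro ⟨hab, hac⟩
    exact ⟨hac, SimpleGraph.Reachable.trans (SimpleGraph.Reachable.symm hab) hac⟩

/-- **Sahi's `E₃` on the three pairwise-separation events of three vertices = the Aas–Gladkov form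
times `(1 + μ(abc))`, minus the product of the three 'one pair' cells.**  For `μ = prodBernoulli w`
and vertices `a, b, c`, with `abc = {a↔b} ∩ {a↔c}`, `a|b|c = {a↔b}ᶜ ∩ {a↔c}ᶜ ∩ {b↔c}ᶜ`,
`ab|c = {a↔b} ∩ {a↔c}ᶜ`, `ac|b = {a↔c} ∩ {a↔b}ᶜ`, `a|bc = {b↔c} ∩ {a↔b}ᶜ`:
`E₃({a↔b}ᶜ, {a↔c}ᶜ, {b↔c}ᶜ) = (1 + μ(abc))·(μ(a|b|c)μ(abc) − [μ(ab|c)μ(ac|b) + μ(ab|c)μ(a|bc) + μ(ac|b)μ(a|bc)]) − μ(ab|c)μ(ac|b)μ(a|bc)`.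
(Bookkeeping identity relating [LiebSahi2021, (2.1)] to [Gladkov2024StrongFKG, Cor. 4.2]; not in the
sources.) [cite: LiebSahi2021, eq. (2.1) (arXiv p. 5); Gladkov2024StrongFKG, Cor. 4.2] -/
theorem prodBernoulli_sahiE3_pairSep_eq (w : Sym2 V → unitInterval) (a b c : V) :
    sahiE3 (prodBernoulli w) (openConn a b)ᶜ (openConn a c)ᶜ (openConn b c)ᶜ =
      (1 + (prodBernoulli w).real (openConn a b ∩ openConn a c)) *
          ((prodBernoulli w).real ((openConn a b)ᶜ ∩ (openConn a c)ᶜ ∩ (openConn b c)ᶜ) *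
              (prodBernoulli w).real (openConn a b ∩ openConn a c) -
            ((prodBernoulli w).real (openConn a b ∩ (openConn a c)ᶜ) *
                (prodBernoulli w).real (openConn a c ∩ (openConn a b)ᶜ) +
              (prodBernoulli w).real (openConn a b ∩ (openConn a c)ᶜ) *
                (prodBernoulli w).real (openConn b c ∩ (openConn a b)ᶜ) +
              (prodBernoulli w).real (openConn a c ∩ (openConn a b)ᶜ) *
                (prodBernoulli w).real (openConn b c ∩ (openConn a b)ᶜ))) -
        (prodBernoulli w).real (openConn a b ∩ (openConn a c)ᶜ) *
          (prodBernoulli w).real (openConn a c ∩ (openConn a b)ᶜ) *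
          (prodBernoulli w).real (openConn b c ∩ (openConn a b)ᶜ) := by
  classical
  set μ := prodBernoulli w with hμ
  set Eab : Set (BondConfig V) := openConn a b with hEab
  set Eac : Set (BondConfig V) := openConn a c with hEac
  set Ebc : Set (BondConfig V) := openConn b c with hEbc
  have mEab : MeasurableSet Eab := MeasurableSet.of_discrete
  have mEac : MeasurableSet Eac := MeasurableSet.of_discrete
  have mEbc : MeasurableSet Ebc := MeasurableSet.of_discrete
  -- the 'all joined' cell
  set T : Set (BondConfig V) := Eab ∩ Eac with hT
  have hT₁ : Eab ∩ Ebc = T := openConn_inter_bc_eq a b c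
  have hT₂ : Eac ∩ Ebc = T := openConn_inter_ac_bc_eq a b c
  -- the four basic masses
  set x := μ.real Eab with hx
  set y := μ.real Eac with hy
  set z := μ.real Ebc with hz
  set t := μ.real T with ht
  -- unions via inclusion–exclusion
  have hU : μ.real (Eab ∪ Eac) = x + y - t := by
    have h := measureReal_union_add_inter (μ := μ) (s := Eab) mEac
    linarith
  have hU3 : μ.real (Eab ∪ Eac ∪ Ebc) = x + y + z - 2 * t := by
    have h := measureReal_union_add_inter (μ := μ) (s := Eab ∪ Eac) mEbc
    have hI : (Eab ∪ Eac) ∩ Ebc = T := by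
      rw [Set.union_inter_distrib_right, hT₁, hT₂, Set.union_self]
    rw [hI] at h
    linarith
  -- single complements
  have cA : μ.real Eabᶜ = 1 - x := probReal_compl_eq_one_sub mEab
  have cB : μ.real Eacᶜ = 1 - y := probReal_compl_eq_one_sub mEac
  have cC : μ.real Ebcᶜ = 1 - z := probReal_compl_eq_one_sub mEbc
  -- double complements
  have cAB : μ.real (Eabᶜ ∩ Eacᶜ) = 1 - x - y + t := by
    rw [← Set.compl_union, probReal_compl_eq_one_sub (mEab.union mEac), hU]
    ring
  have cAC : μ.real (Eabᶜ ∩ Ebcᶜ) = 1 - x - z + t := by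
    have h := measureReal_union_add_inter (μ := μ) (s := Eab) mEbc
    rw [hT₁] at h
    rw [← Set.compl_union, probReal_compl_eq_one_sub (mEab.union mEbc)]
    linarith
  have cBC : μ.real (Eacᶜ ∩ Ebcᶜ) = 1 - y - z + t := by
    have h := measureReal_union_add_inter (μ := μ) (s := Eac) mEbc
    rw [hT₂] at h
    rw [← Set.compl_union, probReal_compl_eq_one_sub (mEac.union mEbc)]
    linarith
  -- the 'all separate' cell
  have cQ : μ.real (Eabᶜ ∩ Eacᶜ ∩ Ebcᶜ) = 1 - x - y - z + 2 * t := by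
    rw [← Set.compl_union, ← Set.compl_union,
      probReal_compl_eq_one_sub ((mEab.union mEac).union mEbc), hU3]
    ring
  -- the three 'one pair' cells
  have u₃ : μ.real (Eab ∩ Eacᶜ) = x - t := by
    have h := measureReal_inter_add_sdiff (μ := μ) (s := Eab) mEac
    rw [Set.sdiff_eq] at h
    linarith
  have u₂ : μ.real (Eac ∩ Eabᶜ) = y - t := by
    have h := measureReal_inter_add_sdiff (μ := μ) (s := Eac) mEab
    rw [Set.sdiff_eq, Set.inter_comm Eac Eab] at h
    linarith
  have u₁ : μ.real (Ebc ∩ Eabᶜ) = z - t := by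
    have h := measureReal_inter_add_sdiff (μ := μ) (s := Ebc) mEab
    rw [Set.sdiff_eq, Set.inter_comm Ebc Eab, hT₁] at h
    linarith
  -- assemble
  rw [sahiE3_def, cQ, cA, cB, cC, cBC, cAC, cAB, u₃, u₂, u₁]
  ring

/-- **The proved part of Kahn's Conjecture 5 on the pairwise-separation triple.**  For
`μ = prodBernoulli w` and vertices `a, b, c`:
`E₃({a↔b}ᶜ, {a↔c}ᶜ, {b↔c}ᶜ) ≥ −μ(ab|c)·μ(ac|b)·μ(a|bc)`,
from `prodBernoulli_sahiE3_pairSep_eq` and the Aas–Gladkov inequality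
`prodBernoulli_threePoint_strongHarris`.  (The full inequality `E₃ ≥ 0` for this triple is an instance of
the open conjecture [cite: Kahn2022, Conjecture 5 (arXiv p. 3)]; this corollary is not stated in the
sources.) [cite: Gladkov2024StrongFKG, Cor. 4.2; Kahn2022, Conjecture 5 (arXiv p. 3)] -/
theorem prodBernoulli_sahiE3_pairSep_ge (w : Sym2 V → unitInterval) (a b c : V) :
    -((prodBernoulli w).real (openConn a b ∩ (openConn a c)ᶜ) *
        (prodBernoulli w).real (openConn a c ∩ (openConn a b)ᶜ) *
        (prodBernoulli w).real (openConn b c ∩ (openConn a b)ᶜ)) ≤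
      sahiE3 (prodBernoulli w) (openConn a b)ᶜ (openConn a c)ᶜ (openConn b c)ᶜ := by
  rw [prodBernoulli_sahiE3_pairSep_eq]
  have hAG := prodBernoulli_threePoint_strongHarris w a b c
  have ht : 0 ≤ (prodBernoulli w).real (openConn a b ∩ openConn a c) := measureReal_nonneg
  have h1 : 0 ≤ 1 + (prodBernoulli w).real (openConn a b ∩ openConn a c) := by linarith
  have h2 : 0 ≤ (prodBernoulli w).real ((openConn a b)ᶜ ∩ (openConn a c)ᶜ ∩ (openConn b c)ᶜ) *
        (prodBernoulli w).real (openConn a b ∩ openConn a c) -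
      ((prodBernoulli w).real (openConn a b ∩ (openConn a c)ᶜ) *
          (prodBernoulli w).real (openConn a c ∩ (openConn a b)ᶜ) +
        (prodBernoulli w).real (openConn a b ∩ (openConn a c)ᶜ) *
          (prodBernoulli w).real (openConn b c ∩ (openConn a b)ᶜ) +
        (prodBernoulli w).real (openConn a c ∩ (openConn a b)ᶜ) *
          (prodBernoulli w).real (openConn b c ∩ (openConn a b)ᶜ)) := by
    linarith
  have h3 := mul_nonneg h1 h2
  linarith

end Literature.Probability.Percolation
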